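import Summits.Parity.GeneralizedHardyLittlewood.Theorems.DicksonFibrationDimOneDefs
import Summits.Parity.GeneralizedHardyLittlewood.Theorems.LeeYangFibresAbsoluteUpgradeSinglesDecaySeq
import Summits.Parity.GeneralizedHardyLittlewood.Theorems.LeeYangFibresAbsoluteUpgradeSinglesDecayLocal
import Summits.Parity.GeneralizedHardyLittlewood.Theorems.LeeYangFibresRelativeDimOneSplitLocalIdentity
import Literature.NumberTheory.Sieve.BoundedClassDensitySieveDimension
import HarnessLib

/-!
# Route `DicksonFibration`, crux `DimOne` (stmt-Parity-0819), line `birth` (sieve-model reshape):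
# helper file 2 for the stub `stub_primeSieve` — the density of the weighted sequence and the local
# identity at one prime

Tools for the registered stub `stub_primeSieve : PrimeSieve` (file
`Theorems/DicksonFibrationDimOneStubPrimeSieve.lean`). For the form `ψ_i = a X + b` of a system `Ψ` of
`t + 1` forms and `F = F_{Ψ₋ᵢ} = ∏_{k ≠ i} (a_k X + b_k)` (`sysPoly (Fin.removeNth i Ψ)`):

* the density `g(d) = ∏_{p ∣ d} g_p` (`d ≥ 1`),
  `g_p = #{s mod p : p ∣ F(s), p ∤ a s + b}/θ_p`, `θ_p = p` (`p ∣ a`) resp. `p − 1` (`p ∤ a`), of the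
  sequence `a_v = Σ_{m : F(m) = v} Λ(a m + b)` is used through the HYPOTHESIS `hg : ∀ d ≠ 0, g d = ∏ …` on
  an arithmetic function `g` (multiplicative by the tree's `BoundedClassDensity.isMultiplicative_of_apply_eq_prod`;
  no definition is introduced); `density_prime` (`g(p) = g_p`);
* `card_goodRoots_mul` (registered sub-goal) — CRT multiplicativity of the good root classes
  `#{s mod d : d ∣ F(s), (a s + b, d) = 1}`, and `density_mul_totient` — the DICTIONARY IDENTITY
  `g(d) φ(|a| d) = #{good s mod d} φ(|a|)` for square-free `d` (so that `g(d) · |a| #I/φ(|a|)` is the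
  expected mass `Σ_{good s} |a| #I/φ(|a| d)` of the class sums of `Λ(a m + b)`);
* `sysPoly_eq_mul` (`F_Ψ = (a X + b) F`), `rootCount_eq_add`
  (`ω_{F_Ψ}(p) = [p ∤ a] + #{good s mod p}` when `(a, b) = 1`), and the LOCAL IDENTITY at one prime
  `lambda_mul_one_sub_density`: `λ_p (1 − g_p) = (p − ω_{F_Ψ}(p))/(p − 1)` with `λ_p = p/(p−1)` (`p ∣ a`)
  resp. `1`.

References: H. Halberstam, H.-E. Richert, *Sieve Methods* (1974), Ch. 1 Example 5 and Ch. 2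
[HalberstamRichert1974]; B. Green, T. Tao, Ann. of Math. 171 (2010), (1.6) and Lemma 1.3 [GreenTao2010].
-/

noncomputable section

open scoped BigOperators Classical
open Finset Polynomial Literature.NumberTheory.Sieve
open Summit.Parity.GeneralizedHardyLittlewood.Theorems.AbsoluteUpgrade

namespace Summit.Parity.GeneralizedHardyLittlewood.Cruxes.DimOne.BirthSieve

/-! ### The density of the weighted sequence -/

section Density

open Summit.Parity.GeneralizedHardyLittlewood.Cruxes.RelativeDimOne.GallagherBackwardsSplit
  (card_filter_range_mul_coprime int_gcd_linear_mod int_gcd_mul_eq_one_iff)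

variable {F : ℤ[X]} {a b : ℤ} {g : ArithmeticFunction ℝ}

/-- At a prime, a density of the shape `g(d) = ∏_{p ∣ d} g_p` takes the value `g_p`; here
`g_p = #{s mod p : p ∣ F(s), p ∤ a s + b}/θ_p`, `θ_p = p` if `p ∣ a` and `θ_p = p − 1` if `p ∤ a`
(`θ_p = φ(|a| p)/φ(|a|)`: the expected mass of `Λ(a m + b)` in a good class modulo `d` is
`|a| #I/φ(|a| d)`). [cite: HalberstamRichert1974, Ch. 1 Example 5] -/
theorem density_prime
    (hg : ∀ d : ℕ, d ≠ 0 → g d = ∏ p ∈ d.primeFactors,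
      (#((rootsMod F p).filter (fun s : ℕ => Int.gcd (a * s + b) p = 1)) : ℝ) /
        (if (p : ℤ) ∣ a then (p : ℝ) else (p : ℝ) - 1))
    {p : ℕ} (hp : p.Prime) :
    g p = (#((rootsMod F p).filter (fun s : ℕ => Int.gcd (a * s + b) p = 1)) : ℝ) /
      (if (p : ℤ) ∣ a then (p : ℝ) else (p : ℝ) - 1) := by
  rw [hg p hp.ne_zero, hp.primeFactors, Finset.prod_singleton]

/-- `θ_p > 0` at a prime. [folklore] -/
theorem theta_pos (a : ℤ) {p : ℕ} (hp : p.Prime) :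
    0 < (if (p : ℤ) ∣ a then (p : ℝ) else (p : ℝ) - 1) := by
  have hp2 : (2 : ℝ) ≤ p := by exact_mod_cast hp.two_le
  split_ifs <;> linarith

/-- The good root classes modulo `1`: exactly one. [folklore] -/
theorem card_goodRoots_one (F : ℤ[X]) (a b : ℤ) :
    #((rootsMod F 1).filter (fun s : ℕ => Int.gcd (a * s + b) ((1 : ℕ) : ℤ) = 1)) = 1 := by
  have h : (rootsMod F 1).filter (fun s : ℕ => Int.gcd (a * s + b) ((1 : ℕ) : ℤ) = 1) = range 1 := by
    rw [rootsMod, Finset.filter_filter]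
    refine Finset.filter_true_of_mem fun s _ => ⟨?_, ?_⟩
    · rw [Nat.cast_one]; exact one_dvd _
    · rw [Nat.cast_one]; exact Int.gcd_one_right _
  rw [h, Finset.card_range]

/-- **CRT multiplicativity of the good root classes**: for coprime `m, n ≥ 1`,
`#{s mod mn : mn ∣ F(s), (a s + b, mn) = 1} = #{s mod m : …} · #{s mod n : …}`. [folklore] -/
theorem card_goodRoots_mul : ∀ (F : Polynomial ℤ) (a b : ℤ) {m n : ℕ}, 0 < m → 0 < n → m.Coprime n → Finset.card ((Summit.Parity.GeneralizedHardyLittlewood.Theorems.AbsoluteUpgrade.rootsMod F (m * n)).filter (fun s : ℕ => Int.gcd (a * s + b) (m * n : ℕ) = 1)) = Finset.card ((Summit.Parity.GeneralizedHardyLittlewood.Theorems.AbsoluteUpgrade.rootsMod F m).filter (fun s : ℕ => Int.gcd (a * s + b) m = 1)) * Finset.card ((Summit.Parity.GeneralizedHardyLittlewood.Theorems.AbsoluteUpgrade.rootsMod F n).filter (fun s : ℕ => Int.gcd (a * s + b) n = 1)) := by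
  intro F a b m n hm hn hmn
  have key := card_filter_range_mul_coprime hm hn hmn
    (fun u : ℕ => (m : ℤ) ∣ F.eval (u : ℤ) ∧ Int.gcd (a * u + b) m = 1)
    (fun v : ℕ => (n : ℤ) ∣ F.eval (v : ℤ) ∧ Int.gcd (a * v + b) n = 1)
  rw [rootsMod, rootsMod, rootsMod, Finset.filter_filter, Finset.filter_filter, Finset.filter_filter,
    ← key]
  congr 1
  refine Finset.filter_congr fun r _ => ?_
  have hcop : IsCoprime (m : ℤ) (n : ℤ) := Nat.isCoprime_iff_coprime.mpr hmn
  rw [int_gcd_mul_eq_one_iff, ← dvd_eval_iff_dvd_eval_mod F m r, ← dvd_eval_iff_dvd_eval_mod F n r,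
    ← int_gcd_linear_mod (dvd_refl m) a b r, ← int_gcd_linear_mod (dvd_refl n) a b r]
  constructor
  · rintro ⟨hd, h1, h2⟩
    rw [Nat.cast_mul] at hd
    exact ⟨⟨dvd_trans (dvd_mul_right _ _) hd, h1⟩, ⟨dvd_trans (dvd_mul_left _ _) hd, h2⟩⟩
  · rintro ⟨⟨hdm, h1⟩, ⟨hdn, h2⟩⟩
    rw [Nat.cast_mul]
    exact ⟨hcop.mul_dvd hdm hdn, h1, h2⟩

/-- **The dictionary identity** `g(d) φ(|a| d) = #{good s mod d} · φ(|a|)` for square-free `d`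
(induction over the primes of `d`: `φ(p A) = θ_p φ(A)` and CRT). [cite: HalberstamRichert1974, Ch. 1 Example 5] -/
theorem density_mul_totient
    (hg : ∀ d : ℕ, d ≠ 0 → g d = ∏ p ∈ d.primeFactors,
      (#((rootsMod F p).filter (fun s : ℕ => Int.gcd (a * s + b) p = 1)) : ℝ) /
        (if (p : ℤ) ∣ a then (p : ℝ) else (p : ℝ) - 1))
    {d : ℕ} (hd : Squarefree d) :
    g d * (Nat.totient (a.natAbs * d) : ℝ) =
      #((rootsMod F d).filter (fun s : ℕ => Int.gcd (a * s + b) d = 1)) * (Nat.totient a.natAbs : ℝ) := by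
  induction d using Nat.strong_induction_on with
  | _ d ih =>
    have hd0 : d ≠ 0 := fun h => by rw [h] at hd; exact not_squarefree_zero hd
    rcases Nat.lt_or_ge 1 d with hd1 | hd1
    · -- `d = p d'` with `p = minFac d ∤ d'`
      have hpp : d.minFac.Prime := Nat.minFac_prime hd1.ne'
      obtain ⟨d', hdd'⟩ : d.minFac ∣ d := Nat.minFac_dvd d
      set p := d.minFac with hp
      have hd'0 : d' ≠ 0 := fun h => hd0 (by rw [hdd', h, mul_zero])
      have hd'pos : 0 < d' := Nat.pos_of_ne_zero hd'0
      have hpd' : ¬ p ∣ d' := fun h => by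
        have hsq : p * p ∣ d := by rw [hdd']; exact Nat.mul_dvd_mul_left p h
        exact hpp.ne_one (Nat.isUnit_iff.mp (hd p hsq))
      have hcop : p.Coprime d' := (Nat.Prime.coprime_iff_not_dvd hpp).mpr hpd'
      have hd'lt : d' < d := by
        rw [hdd']; exact lt_mul_of_one_lt_left hd'pos hpp.one_lt
      have hd'sq : Squarefree d' := hd.squarefree_of_dvd ⟨p, by rw [hdd', mul_comm]⟩
      have ih' := ih d' hd'lt hd'sq
      -- split everything along `d = p d'`
      have hgm : g (p * d') = g p * g d' :=
        (BoundedClassDensity.isMultiplicative_of_apply_eq_prod hg).map_mul_of_coprime hcop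
      have hcount := card_goodRoots_mul F a b hpp.pos hd'pos hcop
      have hφ : ((Nat.totient (a.natAbs * (p * d')) : ℕ) : ℝ) =
          (if (p : ℤ) ∣ a then (p : ℝ) else (p : ℝ) - 1) * (Nat.totient (a.natAbs * d') : ℝ) := by
        have e : a.natAbs * (p * d') = p * (a.natAbs * d') := by ring
        -- `φ(p A) = θ_p φ(A)`
        have htot : ∀ A : ℕ, ((Nat.totient (p * A) : ℕ) : ℝ) =
            (if p ∣ A then (p : ℝ) else (p : ℝ) - 1) * (Nat.totient A : ℝ) := fun A => by
          by_cases hpA : p ∣ A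
          · rw [if_pos hpA, Nat.totient_mul_of_prime_of_dvd hpp hpA, Nat.cast_mul]
          · rw [if_neg hpA, Nat.totient_mul ((Nat.Prime.coprime_iff_not_dvd hpp).mpr hpA), Nat.cast_mul,
              Nat.totient_prime hpp, Nat.cast_sub hpp.one_le, Nat.cast_one]
        rw [e, htot]
        have hiff : p ∣ a.natAbs * d' ↔ (p : ℤ) ∣ a := by
          rw [Int.natCast_dvd, hpp.dvd_mul]
          exact ⟨fun h => h.resolve_right hpd', fun h => Or.inl h⟩
        by_cases h : (p : ℤ) ∣ a
        · rw [if_pos h, if_pos (hiff.mpr h)]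
        · rw [if_neg h, if_neg (fun h' => h (hiff.mp h'))]
      have hθ := (theta_pos a hpp).ne'
      have hgp : g p * (if (p : ℤ) ∣ a then (p : ℝ) else (p : ℝ) - 1) =
          #((rootsMod F p).filter (fun s : ℕ => Int.gcd (a * s + b) p = 1)) := by
        rw [density_prime hg hpp, div_mul_cancel₀ _ hθ]
      have goal' : g (p * d') * (Nat.totient (a.natAbs * (p * d')) : ℝ) =
          #((rootsMod F (p * d')).filter (fun s : ℕ => Int.gcd (a * s + b) (p * d' : ℕ) = 1)) *
            (Nat.totient a.natAbs : ℝ) := by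
        rw [hgm, hφ, hcount, Nat.cast_mul]
        calc g p * g d' *
              ((if (p : ℤ) ∣ a then (p : ℝ) else (p : ℝ) - 1) * (Nat.totient (a.natAbs * d') : ℝ))
            = (g p * (if (p : ℤ) ∣ a then (p : ℝ) else (p : ℝ) - 1)) *
                (g d' * (Nat.totient (a.natAbs * d') : ℝ)) := by ring
          _ = _ := by rw [hgp, ih']; ring
      rwa [← hdd'] at goal'
    · -- `d = 1`
      interval_cases d
      · exact (hd0 rfl).elim
      · rw [card_goodRoots_one, hg 1 one_ne_zero, Nat.primeFactors_one,
          Finset.prod_empty, mul_one, Nat.cast_one, one_mul]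

end Density

/-! ### Splitting off one linear factor; the local identity at one prime -/

section Local

variable {t : ℕ}

/-- `F_Ψ = (a_i X + b_i) · F_{Ψ₋ᵢ}`: splitting off the `i`-th linear factor of the product polynomial.
[folklore] -/
theorem sysPoly_eq_mul (Ψ : Fin (t + 1) → AffLinForm 1) (i : Fin (t + 1)) :
    sysPoly Ψ = (C ((Ψ i).coeff 0) * X + C (Ψ i).const) * sysPoly (Fin.removeNth i Ψ) := by
  unfold sysPoly
  rw [Fin.prod_univ_succAbove _ i]
  rfl

/-- `F_{Ψ₋ᵢ}(m) = ∏_{k ≠ i} ψ_k(m)`, indexed along `i.succAbove`. [folklore] -/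
theorem sysPoly_removeNth_eval (Ψ : Fin (t + 1) → AffLinForm 1) (i : Fin (t + 1)) (m : ℤ) :
    (sysPoly (Fin.removeNth i Ψ)).eval m = ∏ k : Fin t, (Ψ (i.succAbove k)).eval (fun _ => m) := by
  rw [sysPoly_eval]
  rfl

/-- **Roots of `F_Ψ` versus good root classes of `F_{Ψ₋ᵢ}`.** For a prime `p` and `(a_i, b_i) = 1`:
`ω_{F_Ψ}(p) = [p ∤ a_i] + #{s mod p : p ∣ F_{Ψ₋ᵢ}(s), p ∤ a_i s + b_i}` (the roots of `F_Ψ` are the roots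
of `F_{Ψ₋ᵢ}` together with the root of `ψ_i`, which exists iff `p ∤ a_i`). [folklore] -/
theorem rootCount_eq_add (Ψ : Fin (t + 1) → AffLinForm 1) (i : Fin (t + 1)) {p : ℕ} (hp : p.Prime)
    (hab : IsCoprime ((Ψ i).coeff 0) (Ψ i).const) :
    (polyRootCountMod ![sysPoly Ψ] p : ℝ) =
      (if (p : ℤ) ∣ (Ψ i).coeff 0 then 0 else 1) +
        #((rootsMod (sysPoly (Fin.removeNth i Ψ)) p).filter
          (fun s : ℕ => Int.gcd ((Ψ i).coeff 0 * s + (Ψ i).const) p = 1)) := by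
  set a := (Ψ i).coeff 0 with ha
  set b := (Ψ i).const with hb
  set F := sysPoly (Fin.removeNth i Ψ) with hF
  have hp' : Prime (p : ℤ) := Nat.prime_iff_prime_int.mp hp
  set A := (range p).filter (fun s : ℕ => (p : ℤ) ∣ a * s + b) with hA
  set R := rootsMod F p with hR
  -- the roots of `F_Ψ` modulo `p` are `A ∪ R`
  have hroots : rootsMod (sysPoly Ψ) p = A ∪ R := by
    rw [hA, hR, rootsMod, rootsMod, ← Finset.filter_or]
    refine Finset.filter_congr fun s _ => ?_
    rw [sysPoly_eq_mul Ψ i, Polynomial.eval_mul]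
    simp only [eval_add, eval_mul, eval_C, eval_X]
    exact hp'.dvd_mul
  have hgcd : ∀ v : ℤ, Int.gcd v p = 1 ↔ ¬ (p : ℤ) ∣ v := fun v => by
    rw [Int.gcd_eq_natAbs, Int.natAbs_natCast, ← Nat.coprime_iff_gcd_eq_one, Nat.coprime_comm,
      hp.coprime_iff_not_dvd, Int.natCast_dvd]
  have hRA : R \ A = R.filter (fun s : ℕ => Int.gcd (a * s + b) p = 1) := by
    ext s
    simp only [hA, Finset.mem_sdiff, Finset.mem_filter, Finset.mem_range, hgcd, not_and]
    constructor
    · rintro ⟨hsR, hsA⟩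
      exact ⟨hsR, hsA (mem_rootsMod.mp hsR).1⟩
    · rintro ⟨hsR, h⟩
      exact ⟨hsR, fun _ => h⟩
  have hcard : #(rootsMod (sysPoly Ψ) p) = #A + #(R.filter (fun s : ℕ => Int.gcd (a * s + b) p = 1)) := by
    rw [hroots, ← hRA, ← Finset.card_union_of_disjoint Finset.disjoint_sdiff,
      Finset.union_sdiff_self_eq_union]
  -- `#A = [p ∤ a]`
  have hAcard : (#A : ℝ) = if (p : ℤ) ∣ a then 0 else 1 := by
    by_cases hpa : (p : ℤ) ∣ a
    · rw [if_pos hpa]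
      have hpb : ¬ (p : ℤ) ∣ b := fun hpb =>
        hp'.not_unit (hab.isUnit_of_dvd' hpa hpb)
      have hA0 : A = ∅ := by
        refine Finset.filter_false_of_mem fun s _ h => hpb ?_
        have : (p : ℤ) ∣ a * s := dvd_mul_of_dvd_left hpa _
        exact (dvd_add_right this).mp h
      rw [hA0, Finset.card_empty, Nat.cast_zero]
    · rw [if_neg hpa]
      have hle : #A ≤ 1 := RoughTuple.card_filter_linear_le_one hp hpa
      have hge : 1 ≤ #A := by
        haveI := Fact.mk hp
        have ha0 : (a : ZMod p) ≠ 0 := by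
          rwa [Ne, ZMod.intCast_zmod_eq_zero_iff_dvd]
        set x₀ : ZMod p := -(b : ZMod p) * (a : ZMod p)⁻¹ with hx₀
        refine Finset.card_pos.mpr ⟨x₀.val, Finset.mem_filter.mpr ⟨Finset.mem_range.mpr (ZMod.val_lt x₀), ?_⟩⟩
        rw [← ZMod.intCast_zmod_eq_zero_iff_dvd]
        push_cast
        rw [ZMod.natCast_val, ZMod.cast_id', id, hx₀]
        field_simp
        ring
      have : #A = 1 := le_antisymm hle hge
      rw [this, Nat.cast_one]
  rw [← card_rootsMod, hcard, Nat.cast_add, hAcard]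

/-- **The local identity at one prime.** For a prime `p` and `(a_i, b_i) = 1`, with
`λ_p = p/(p − 1)` if `p ∣ a_i` and `λ_p = 1` otherwise:
`λ_p (1 − g_p) = (p − ω_{F_Ψ}(p))/(p − 1)`. [cite: GreenTao2010, (1.6)] -/
theorem lambda_mul_one_sub_density (Ψ : Fin (t + 1) → AffLinForm 1) (i : Fin (t + 1))
    {g : ArithmeticFunction ℝ}
    (hg : ∀ d : ℕ, d ≠ 0 → g d = ∏ p ∈ d.primeFactors,
      (#((rootsMod (sysPoly (Fin.removeNth i Ψ)) p).filter
          (fun s : ℕ => Int.gcd ((Ψ i).coeff 0 * s + (Ψ i).const) p = 1)) : ℝ) /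
        (if (p : ℤ) ∣ (Ψ i).coeff 0 then (p : ℝ) else (p : ℝ) - 1))
    {p : ℕ} (hp : p.Prime) (hab : IsCoprime ((Ψ i).coeff 0) (Ψ i).const) :
    (if (p : ℤ) ∣ (Ψ i).coeff 0 then (p : ℝ) / (p - 1) else 1) * (1 - g p) =
      ((p : ℝ) - polyRootCountMod ![sysPoly Ψ] p) / (p - 1) := by
  have hp2 : (2 : ℝ) ≤ p := by exact_mod_cast hp.two_le
  have hp1 : (p : ℝ) - 1 ≠ 0 := by linarith
  have hp0 : (p : ℝ) ≠ 0 := by linarith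
  rw [rootCount_eq_add Ψ i hp hab, density_prime hg hp]
  by_cases hpa : (p : ℤ) ∣ (Ψ i).coeff 0
  · simp only [if_pos hpa]
    field_simp
    ring
  · simp only [if_neg hpa]
    field_simp
    ring

end Local

end Summit.Parity.GeneralizedHardyLittlewood.Cruxes.DimOne.BirthSieve

end
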